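import Summits.Langlands.Langlands.Theorems.SoloInformedGLOneRationalField
import HarnessLib

/-!
# Λ42 — The ORIGINAL `GL₁` summit conjunct over `ℚ` is exactly Fontaine's `WD`-value clause

Solo (informed) programme, rung Λ42 (bookkeeping for Λ41).  Λ22
(`globalLanglandsCorrespondenceGLn_one_iff_pst`) computed the summit's original (unrepaired)
`n = 1` conjunct `GlobalLanglandsCorrespondenceGLn 1 K 𝓡 hcpt` as the conjunction of three clauses:
(dR) Weil's characters `r_{θ,ι}` are de Rham above `ℓ` for the pinned datum, (WD) the pinned datum
attaches to `r_{θ,ι}|Γ_{K_v}` a Weil–Deligne representation of `ι`-class `rec₁(θ_v ∘ det)`, and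
(FM₁) rank-one Fontaine–Mazur for `K`; and Λ22 `…_iff_wd_of_facts` isolated (WD) granting the two
named facts (dR) and (FM₁).  Both named facts are now THEOREMS in the relevant cases: (dR) for every
field with a real place (Λ27 `isDeRhamFramed_weilRep_toLocal_of_isReal`) and (FM₁) over `ℚ`
(Λ41 `fontaineMazurOne_rat`, from Stage C's proof of Tate's theorem in degree one).  Hence:

* `globalLanglandsCorrespondenceGLn_one_iff_wd_of_isReal_of_fm` — over a field with a real place,
  granting only the `K`-instance of rank-one Fontaine–Mazur, the original conjunct ⟺ (WD);
* ★★★ `globalLanglandsCorrespondenceGLn_one_rat_iff_wd` — **over `ℚ`, with no named fact and no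
  hypothesis, the summit's ORIGINAL `n = 1` conjunct is EQUIVALENT to the bare clause (WD)**: "for
  every algebraic Hecke character `θ` of `ℚ`, every `ℓ`, `ι : ℚ̄_ℓ ≃ ℂ` and the place `v = ℓ`, the
  pinned Fontaine datum attaches to `r_{θ,ι}|Γ_{ℚ_ℓ}` a Weil–Deligne representation whose
  `ι`-transport has Frobenius-semisimple class `rec₁(θ_ℓ ∘ det)`" — a clause about the VALUE of the
  datum's `WD`-component, which the datum's specification leaves undetermined
  (`SoloInformedPinExclusionSpec`).  Everything else in the original `GL₁` conjunct over `ℚ` is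
  settled in the tree.

Plain theorems; no definitions.

Citations: [BuzzardGeeLMS2014] Conj. 3.2.1–3.2.2 and Rem. 3.2.5; [FontaineAsterisque223VIII] §2.3.7;
[FontaineMazurGeometric1995] Conj. 1; [Patrikis2019] Prop. 2.2.1; [SerreAbelianLadic1968] Ch. III
§2.3 and App. A.
-/

noncomputable section
open scoped MatrixGroups Matrix Classical Polynomial NumberField
open NumberField IsDedekindDomain Field Polynomial Filter
open Literature.NumberTheory.Automorphic Literature.NumberTheory.GaloisRepresentations
open Literature.NumberTheory.PAdicHodge

namespace Summit.Langlands.Langlands.Theorems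

namespace GLOneRigidity

section RealPlace

variable {K : Type} [Field K] [NumberField K] {hcpt : isCompact_glFiniteIntegralLevel 1 K}

/-- Over a number field with a real place, granting only the `K`-instance of rank-one Fontaine–Mazur
(pinned datum), the summit's ORIGINAL `n = 1` conjunct ⟺ Fontaine's `WD`-value clause (WD)
(Λ22 `globalLanglandsCorrespondenceGLn_one_iff_pst` + Λ27 `isDeRhamFramed_weilRep_toLocal_of_isReal`).
[cite: BuzzardGeeLMS2014, Conj. 3.2.2 and Rem. 3.2.5] [cite: FontaineAsterisque223VIII, §2.3.7]
[cite: FontaineMazurGeometric1995, Conj. 1] -/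
theorem globalLanglandsCorrespondenceGLn_one_iff_wd_of_isReal_of_fm {w : InfinitePlace K}
    (hw : w.IsReal)
    (hFM : ∀ (ℓ : ℕ) [Fact ℓ.Prime] (ι : PadicAlgCl ℓ ≃+* ℂ) (ρ : FramedGaloisRep K (PadicAlgCl ℓ) 1),
      (∀ (v : HeightOneSpectrum (𝓞 K)) (hv : ((ℓ : ℕ) : 𝓞 K) ∈ v.asIdeal),
        (fontainePstAdicCompletion v ℓ hv).IsDeRhamFramed (ρ.toLocal v)) →
      ∃ (θ : HeckeCharacter K) (p q : InfinitePlace K → ℤ) (hinf : θ.HasInfinityType p q)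
        (T : Finset (HeightOneSpectrum (𝓞 K))) (e : HeightOneSpectrum (𝓞 K) → ℕ)
        (hmod : HeckeCharacter.IsModulus θ T e), ρ = hinf.weilRep hmod ι)
    (𝓡 : ReciprocityData K) :
    GlobalLanglandsCorrespondenceGLn 1 K 𝓡 hcpt ↔
      ∀ (θ : HeckeCharacter K) (p q : InfinitePlace K → ℤ) (hinf : θ.HasInfinityType p q)
        (T : Finset (HeightOneSpectrum (𝓞 K))) (e : HeightOneSpectrum (𝓞 K) → ℕ)
        (hmod : HeckeCharacter.IsModulus θ T e) (ℓ : ℕ) [Fact ℓ.Prime] (ι : PadicAlgCl ℓ ≃+* ℂ)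
        (v : HeightOneSpectrum (𝓞 K)) (hv : ((ℓ : ℕ) : 𝓞 K) ∈ v.asIdeal),
        ∃ (r : WeilDeligneRep (v.adicCompletion K) (PadicAlgCl ℓ) (Fin 1 → PadicAlgCl ℓ))
          (rℂ : WeilDeligneRep (v.adicCompletion K) ℂ (Fin 1 → ℂ)),
          (𝓡.pst ℓ v hv).IsWeilDeligneOf ((hinf.weilRep hmod ι).toLocal v) r ∧
            r.IsTransportAlong (ι : PadicAlgCl ℓ →+* ℂ) rℂ ∧
            rℂ.HasFrobSemisimpleClass
              ((𝓡.llc v).recGL 1 (IrrClass.mk (SmoothIrrep.ofQuasiChar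
                (⟨θ.localComponent v, θ.continuous_localComponent v⟩ :
                  QuasiChar (v.adicCompletion K))))) := by
  rw [globalLanglandsCorrespondenceGLn_one_iff_pst 𝓡]
  refine ⟨fun h θ p q hinf T e hmod ℓ _ ι v hv => (h.1 θ p q hinf T e hmod ℓ ι v hv).2,
    fun h => ⟨fun θ p q hinf T e hmod ℓ _ ι v hv =>
      ⟨isDeRhamFramed_weilRep_toLocal_of_isReal hw ι hinf hmod v hv, h θ p q hinf T e hmod ℓ ι v hv⟩,
      fun ℓ _ ι ρ hdR => hFM ℓ ι ρ hdR⟩⟩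

end RealPlace

section RationalField

variable {hcpt : isCompact_glFiniteIntegralLevel 1 ℚ}

/-- ★★★ **Over `ℚ`, unconditionally, the summit's ORIGINAL `n = 1` conjunct
`GlobalLanglandsCorrespondenceGLn 1 ℚ 𝓡 hcpt` is EQUIVALENT to Fontaine's `WD`-value clause alone**:
for every algebraic Hecke character `θ` of `ℚ`, every `ℓ`, `ι` and `v ∣ ℓ`, the pinned datum attaches
to `r_{θ,ι}|Γ_{ℚ_v}` a Weil–Deligne representation whose `ι`-transport has Frobenius-semisimple class
`rec₁(θ_v ∘ det)` (the real place of `ℚ` discharges (dR), Λ27; Λ41 `fontaineMazurOne_rat`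
discharges (FM₁)). [cite: BuzzardGeeLMS2014, Conj. 3.2.1–3.2.2 and Rem. 3.2.5]
[cite: FontaineAsterisque223VIII, §2.3.7] [cite: FontaineMazurGeometric1995, Conj. 1]
[cite: Patrikis2019, Prop. 2.2.1] -/
theorem globalLanglandsCorrespondenceGLn_one_rat_iff_wd (𝓡 : ReciprocityData ℚ) :
    GlobalLanglandsCorrespondenceGLn 1 ℚ 𝓡 hcpt ↔
      ∀ (θ : HeckeCharacter ℚ) (p q : InfinitePlace ℚ → ℤ) (hinf : θ.HasInfinityType p q)
        (T : Finset (HeightOneSpectrum (𝓞 ℚ))) (e : HeightOneSpectrum (𝓞 ℚ) → ℕ)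
        (hmod : HeckeCharacter.IsModulus θ T e) (ℓ : ℕ) [Fact ℓ.Prime] (ι : PadicAlgCl ℓ ≃+* ℂ)
        (v : HeightOneSpectrum (𝓞 ℚ)) (hv : ((ℓ : ℕ) : 𝓞 ℚ) ∈ v.asIdeal),
        ∃ (r : WeilDeligneRep (v.adicCompletion ℚ) (PadicAlgCl ℓ) (Fin 1 → PadicAlgCl ℓ))
          (rℂ : WeilDeligneRep (v.adicCompletion ℚ) ℂ (Fin 1 → ℂ)),
          (𝓡.pst ℓ v hv).IsWeilDeligneOf ((hinf.weilRep hmod ι).toLocal v) r ∧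
            r.IsTransportAlong (ι : PadicAlgCl ℓ →+* ℂ) rℂ ∧
            rℂ.HasFrobSemisimpleClass
              ((𝓡.llc v).recGL 1 (IrrClass.mk (SmoothIrrep.ofQuasiChar
                (⟨θ.localComponent v, θ.continuous_localComponent v⟩ :
                  QuasiChar (v.adicCompletion ℚ))))) := by
  obtain ⟨w, hw⟩ := exists_isReal_of_odd_finrank (K := ℚ) (by rw [Module.finrank_self]; exact odd_one)
  exact globalLanglandsCorrespondenceGLn_one_iff_wd_of_isReal_of_fm hw
    (fun ℓ _ ι ρ hdR => fontaineMazurOne_rat 𝓡 ι ρ hdR) 𝓡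

end RationalField

end GLOneRigidity

end Summit.Langlands.Langlands.Theorems

end
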